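import Mathlib.Analysis.ODE.ExistUnique
import Mathlib.Analysis.Calculus.ContDiff.RCLike
import Mathlib.Analysis.Calculus.ContDiff.Operations
import Mathlib.Analysis.Calculus.Deriv.Prod
import Literature.Analysis.FluidPDE.CompressibleEulerImplosionMonatomicAlgebra
import HarnessLib

/-!
# Buckmaster–Cao-Labora–Gómez-Serrano at `γ = 5/3`: uniqueness for the autonomous system (1.8)

Topic `Literature/Analysis/FluidPDE`; namespace
`Literature.Analysis.FluidPDE.BuckmasterCaolaboraGomezserrano2025.Monatomic`. Companion of
`CompressibleEulerImplosion.lean` (named fact `BuckmasterCaolaboraGomezserrano2025_thm11_monatomic`,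
THEOREM 1.1 of T. Buckmaster, G. Cao-Labora, J. Gómez-Serrano, *Smooth imploding solutions for 3D
compressible fluids*, Forum Math. Pi 13 (2025) e6, arXiv:2208.09445, at `γ = 5/3`, `α = 1/3`)
and of `CompressibleEulerImplosionMonatomicAlgebra.lean` (Brick B: `DW`, `DZ`, `NW`, `NZ`).
Brick A-uniq of the discharge plan: the uniqueness half of Proposition 1.6 / the standard ODE
theory the paper invokes ("by uniqueness", proof of Prop. 3.1; "uniqueness ⇒ the `P₀`-curve is
the `ν₋` curve", §6): two solutions of `W′ = N_W/D_W`, `Z′ = N_Z/D_Z` on an open interval, both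
staying in `{D_W ≠ 0} ∩ {D_Z ≠ 0}`, which agree at one time agree on the whole interval. The
vector field is `C¹` off the sonic lines, hence locally Lipschitz (Mathlib
`ContDiffAt.exists_lipschitzOnWith`); local uniqueness (`ODE_solution_unique_of_eventually`) is
propagated along the interval by connectedness. Theorems only.
[cite: BuckmasterCaolaboraGomezserrano2025, Prop. 1.6, proof of Prop. 3.1, §6]
-/

noncomputable section

open Set Filter Topology

namespace Literature.Analysis.FluidPDE

namespace BuckmasterCaolaboraGomezserrano2025

namespace Monatomic

/-- The vector field of (1.8) on the phase plane: `F(W,Z) = (N_W/D_W, N_Z/D_Z)`.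
[cite: BuckmasterCaolaboraGomezserrano2025, eq. (1.8)] -/
def field (r : ℝ) (p : ℝ × ℝ) : ℝ × ℝ := (NW r p.1 p.2 / DW p.1 p.2, NZ r p.1 p.2 / DZ p.1 p.2)

/-- The field is `C¹` (indeed `C^∞`) off the sonic lines. [folklore] -/
theorem contDiffAt_field {r : ℝ} {p : ℝ × ℝ} (hDW : DW p.1 p.2 ≠ 0) (hDZ : DZ p.1 p.2 ≠ 0) :
    ContDiffAt ℝ 1 (field r) p := by
  have h1 : ContDiffAt ℝ 1 (fun q : ℝ × ℝ => q.1) p := contDiffAt_fst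
  have h2 : ContDiffAt ℝ 1 (fun q : ℝ × ℝ => q.2) p := contDiffAt_snd
  unfold field NW NZ DW DZ
  refine ContDiffAt.prodMk ?_ ?_
  · refine ContDiffAt.div ?_ ?_ (by simpa [DW] using hDW)
    · exact ((contDiffAt_const.add ((contDiffAt_const.mul h1).div_const _)).add
        (h2.div_const _)).neg.mul h1 |>.add ((h2.pow 2).div_const _)
    · exact contDiffAt_const.add (((contDiffAt_const.mul h1).add h2).div_const _)
  · refine ContDiffAt.div ?_ ?_ (by simpa [DZ] using hDZ)
    · exact ((contDiffAt_const.add (h1.div_const _)).add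
        ((contDiffAt_const.mul h2).div_const _)).neg.mul h2 |>.add ((h1.pow 2).div_const _)
    · exact contDiffAt_const.add ((h1.add (contDiffAt_const.mul h2)).div_const _)

/-- **Local uniqueness.** Two solutions of (1.8) off the sonic lines which agree at `t₀` agree near
`t₀`. [cite: BuckmasterCaolaboraGomezserrano2025, Prop. 1.6] -/
theorem eventuallyEq_of_field {r : ℝ} {c₁ c₂ : ℝ → ℝ × ℝ} {t₀ : ℝ}
    (h₁ : ∀ᶠ t in 𝓝 t₀, HasDerivAt c₁ (field r (c₁ t)) t)
    (h₂ : ∀ᶠ t in 𝓝 t₀, HasDerivAt c₂ (field r (c₂ t)) t)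
    (hD : DW (c₁ t₀).1 (c₁ t₀).2 ≠ 0 ∧ DZ (c₁ t₀).1 (c₁ t₀).2 ≠ 0) (heq : c₁ t₀ = c₂ t₀) :
    c₁ =ᶠ[𝓝 t₀] c₂ := by
  obtain ⟨K, S, hS, hK⟩ := (contDiffAt_field (r := r) hD.1 hD.2).exists_lipschitzOnWith
  have hc₁ : ContinuousAt c₁ t₀ := (h₁.self_of_nhds).continuousAt
  have hc₂ : ContinuousAt c₂ t₀ := (h₂.self_of_nhds).continuousAt
  have hm₁ : ∀ᶠ t in 𝓝 t₀, c₁ t ∈ S := hc₁.preimage_mem_nhds hS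
  have hm₂ : ∀ᶠ t in 𝓝 t₀, c₂ t ∈ S := hc₂.preimage_mem_nhds (by rw [← heq]; exact hS)
  exact ODE_solution_unique_of_eventually (v := fun _ => field r) (s := fun _ => S)
    (Eventually.of_forall fun _ => hK) (h₁.and hm₁) (h₂.and hm₂) heq

/-- **Uniqueness on an interval** (Proposition 1.6, uniqueness half, at `γ = 5/3`): two solutions
of (1.8) on `(a, b)`, one of which stays off the sonic lines `{D_W = 0} ∪ {D_Z = 0}`, which agree
at some `t₀ ∈ (a, b)`, agree on `(a, b)`. [cite: BuckmasterCaolaboraGomezserrano2025, Prop. 1.6] -/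
theorem eqOn_of_field {r : ℝ} {c₁ c₂ : ℝ → ℝ × ℝ} {a b t₀ : ℝ} (ht₀ : t₀ ∈ Ioo a b)
    (h₁ : ∀ t ∈ Ioo a b, HasDerivAt c₁ (field r (c₁ t)) t)
    (h₂ : ∀ t ∈ Ioo a b, HasDerivAt c₂ (field r (c₂ t)) t)
    (hD : ∀ t ∈ Ioo a b, DW (c₁ t).1 (c₁ t).2 ≠ 0 ∧ DZ (c₁ t).1 (c₁ t).2 ≠ 0)
    (heq : c₁ t₀ = c₂ t₀) : EqOn c₁ c₂ (Ioo a b) := by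
  -- the set of times near which the solutions agree
  set u : Set ℝ := {t | t ∈ Ioo a b ∧ c₁ =ᶠ[𝓝 t] c₂} with hu
  have hev : ∀ t ∈ Ioo a b, ∀ᶠ s in 𝓝 t, s ∈ Ioo a b := fun t ht => isOpen_Ioo.mem_nhds ht
  have hd₁ : ∀ t ∈ Ioo a b, ∀ᶠ s in 𝓝 t, HasDerivAt c₁ (field r (c₁ s)) s :=
    fun t ht => (hev t ht).mono fun s hs => h₁ s hs
  have hd₂ : ∀ t ∈ Ioo a b, ∀ᶠ s in 𝓝 t, HasDerivAt c₂ (field r (c₂ s)) s :=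
    fun t ht => (hev t ht).mono fun s hs => h₂ s hs
  -- `u` is open
  have hu_open : IsOpen u := by
    rw [isOpen_iff_mem_nhds]
    rintro t ⟨ht, hte⟩
    have : ∀ᶠ s in 𝓝 t, c₁ =ᶠ[𝓝 s] c₂ := hte.eventually_nhds
    exact ((hev t ht).and this).mono fun s hs => hs
  -- `t₀ ∈ u`
  have ht₀u : t₀ ∈ u := ⟨ht₀, eventuallyEq_of_field (hd₁ t₀ ht₀) (hd₂ t₀ ht₀) (hD t₀ ht₀) heq⟩
  -- relative closedness: a point of `(a,b)` in the closure of `u` belongs to `u`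
  have hcl : closure u ∩ Ioo a b ⊆ u := by
    rintro t ⟨htc, ht⟩
    have hc₁ : ContinuousAt c₁ t := (h₁ t ht).continuousAt
    have hc₂ : ContinuousAt c₂ t := (h₂ t ht).continuousAt
    -- `c₁ t = c₂ t` by continuity
    have hEq : c₁ t = c₂ t := by
      have hmem : t ∈ closure {s | c₁ s = c₂ s} :=
        closure_mono (fun s hs => (hs.2 : c₁ =ᶠ[𝓝 s] c₂).eq_of_nhds) htc
      by_contra hne
      have hopen : IsOpen {p : (ℝ × ℝ) × (ℝ × ℝ) | p.1 ≠ p.2} := isOpen_ne_fun continuous_fst continuous_snd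
      have : ∀ᶠ s in 𝓝 t, c₁ s ≠ c₂ s :=
        (hc₁.prodMk hc₂).preimage_mem_nhds (hopen.mem_nhds hne)
      obtain ⟨V, hV, hVsub⟩ : ∃ V ∈ 𝓝 t, ∀ s ∈ V, c₁ s ≠ c₂ s := eventually_iff_exists_mem.mp this
      obtain ⟨s, hsV, hs⟩ := mem_closure_iff_nhds.mp hmem V hV
      exact hVsub s hsV hs
    exact ⟨ht, eventuallyEq_of_field (hd₁ t ht) (hd₂ t ht) (hD t ht) hEq⟩
  have hsub : Ioo a b ⊆ u :=
    isPreconnected_Ioo.subset_of_closure_inter_subset hu_open ⟨t₀, ht₀, ht₀u⟩ hcl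
  intro t ht
  exact ((hsub ht).2 : c₁ =ᶠ[𝓝 t] c₂).eq_of_nhds

/-- The same in coordinates: solutions `(W₁, Z₁)`, `(W₂, Z₂)` of `W′ = N_W/D_W`, `Z′ = N_Z/D_Z` on
`(a, b)`, the first off the sonic lines, agreeing at `t₀`, agree on `(a, b)`.
[cite: BuckmasterCaolaboraGomezserrano2025, Prop. 1.6] -/
theorem eqOn_of_field' {r : ℝ} {W₁ Z₁ W₂ Z₂ : ℝ → ℝ} {a b t₀ : ℝ} (ht₀ : t₀ ∈ Ioo a b)
    (hW₁ : ∀ t ∈ Ioo a b, HasDerivAt W₁ (NW r (W₁ t) (Z₁ t) / DW (W₁ t) (Z₁ t)) t)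
    (hZ₁ : ∀ t ∈ Ioo a b, HasDerivAt Z₁ (NZ r (W₁ t) (Z₁ t) / DZ (W₁ t) (Z₁ t)) t)
    (hW₂ : ∀ t ∈ Ioo a b, HasDerivAt W₂ (NW r (W₂ t) (Z₂ t) / DW (W₂ t) (Z₂ t)) t)
    (hZ₂ : ∀ t ∈ Ioo a b, HasDerivAt Z₂ (NZ r (W₂ t) (Z₂ t) / DZ (W₂ t) (Z₂ t)) t)
    (hD : ∀ t ∈ Ioo a b, DW (W₁ t) (Z₁ t) ≠ 0 ∧ DZ (W₁ t) (Z₁ t) ≠ 0)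
    (hW : W₁ t₀ = W₂ t₀) (hZ : Z₁ t₀ = Z₂ t₀) :
    EqOn W₁ W₂ (Ioo a b) ∧ EqOn Z₁ Z₂ (Ioo a b) := by
  have h := eqOn_of_field (r := r) (c₁ := fun t => (W₁ t, Z₁ t)) (c₂ := fun t => (W₂ t, Z₂ t)) ht₀
    (fun t ht => (hW₁ t ht).prodMk (hZ₁ t ht)) (fun t ht => (hW₂ t ht).prodMk (hZ₂ t ht)) hD
    (Prod.ext hW hZ)
  exact ⟨fun t ht => congrArg Prod.fst (h ht), fun t ht => congrArg Prod.snd (h ht)⟩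

end Monatomic

end BuckmasterCaolaboraGomezserrano2025

end Literature.Analysis.FluidPDE
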